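import Literature.AnabelianGeometry.EtaleTheta.ThetaRootOrbitsMonodromyToyCor28i
import HarnessLib

/-!
# [EtTh] Cor. 2.8 (iii) at the MONODROMY TOY (PROOF-ONLY rider of parts A/B1/B2): the print-recipe datum also
# VIOLATES the typed `Cor28_iii` — the loop `t` lies in the toy's `Π^tp_{Ẋ̲}` and moves `η̈^{Θ,l·ℤ} = {η₀}`

S. Mochizuki, *The étale theta function and its Frobenioid-theoretic manifestations* [EtTh], Publ. RIMS **45**
(2009), §2 Cor. 2.8 (iii) p. 42 («if … `γ` arises from an inner automorphism of `Π^tp_{Ẋ̲̲}` (resp. `Π^tp_{Ẋ̲}`; …), then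
`γ` preserves `η̲̈^{Θ,l·ℤ}` (resp. `η̈^{Θ,l·ℤ}`; …)»), Rmk. 2.1.1 p. 36, Def. 2.5 p. 39 (PRIMS text pages)
[cite: MochizukiEtTh2009, Cor 2.8(iii) p.42].  Cell `abc-iut`, F lane (FACT-LIST row F-0641 `ThetaOrbitData.Cor28_iii`:
∀-closure REFUTED by abc-iut-w4-d051's junk datum `not_forall_cor28_iii`; positive instance forms abc-iut-L2-t2
`ofEmbedding_cor28_iii_inner`, abc-iut-w6-d049, abc-iut-w6-d050, abc-iut-f-193 at the χ′ cover of record), seat abc-iut-f-128 (gen 14);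
count-neutral rider under abc-iut-L2-lead R1504/R1515.  Carrier and datum: abc-iut-w6-d084's `monodromyModel l hl` and
part A's `thetaOrbitData l hl` (`ThetaRootOrbitsMonodromyToy.lean`).
HONEST LABEL (abc-iut-L2-lead R1352, verbatim): «a DESIGNED tempered toy with print's monodromy combinatorics — loop ↦
`Δ̄^ell` (`b`-cycle), the inversion INVERTS it, unipotent monodromy `x ↦ x·z` on the `a`-cycle, `z` = cusp inertia = `Δ̄_Θ`
central; `G_K := 1`; NOT a Tate curve, NOT the tempered fundamental group of a curve; consistency ≠ faithfulness; nothing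
here takes a side on anything printed.»

RESULT: `not_cor28_iii` — clause 2 of the typed `Cor28_iii` («`x ∈ Π^tp_{Ẋ̲} = Π^tp_{X̲} ∩ Π^tp_Ċ` ⇒ `γ_x` preserves
`η̈^{Θ,l·ℤ}` EXACTLY») fails for `x = t`: in the toy `t ∈ Π^tp_{X̲} = {b = 0, d rotation}` (its `X̲ → X` kills the
`a`-cycle, `not_def25Conditions` of part B2) and `t ∈ Π^tp_Ċ = {e = 1}`, while `γ_t` is the shear and carries
`η̈^{Θ,l·ℤ} = {η₀}` to `{η_{1,1}} ≠ {η₀}` (`l ≠ 1`).  In print `t ∉ Π^tp_{X̲}` (only `t^l` is, and the `l·ℤ`-orbit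
absorbs it) — the SAME Def. 2.5 (i)(a) artefact as `not_cor28_i`; refutable-as-typed-at-a-design-carrier ≠ refuted in
print.  PROOF-ONLY (0 `def`, 0 `instance`, 0 notation); no bearing on [IUTchIII] Cor. 3.12; no side taken; typed ≠ proved.
-/

noncomputable section

namespace Literature.AnabelianGeometry.EtaleTheta.ThetaCovers.MonodromyModel

open Multiplicative HeisenbergWitness TemperedModel DihedralGroup ThetaOrbitData

variable (l : ℕ) [NeZero l] (hl : Odd l)

/-- `t ∈ Π^tp_{Ẋ̲} = Π^tp_{X̲} ∩ Π^tp_Ċ` in the toy (`b = 0`, `d = r 1` a rotation, `e = 1`). (toy bookkeeping for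
[EtTh] Def. 2.5 (ii); no claim about print) [cite: MochizukiEtTh2009, Def 2.5 p.39] -/
theorem tT_mem_dotXu :
    tT l ∈ (monodromyModel l hl).tp (monodromyModel l hl).PiXu ⊓ (monodromyModel l hl).PiCdot := by
  refine Subgroup.mem_inf.mpr ⟨?_, ?_⟩
  · rw [tp_PiXu l hl]
    exact (tT_mem l).2.1
  · exact (mem_PiCdotT l).mpr rfl

/-- **`γ_t` moves `η̈^{Θ,l·ℤ} = {η₀}`**: its transport along `(γ_t, Γ_Θ)` (any induced `Γ_Θ`) is `{η_{1,1}} ≠ {η₀}`.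
(toy bookkeeping for [EtTh] Cor. 2.8 (iii); no claim about print) [cite: MochizukiEtTh2009, Cor 2.8(iii) p.42] -/
theorem transport_innerAutTop_tT_etaCollLZ_ne (hl1 : l ≠ 1) {ΓΘ : DTh l ≃* DTh l}
    (hind : (thetaOrbitData l hl).InducesOnTheta (innerAutTop (T := monodromyModel l hl) (tT l)) ΓΘ)
    (hY : (PiYddT l).map (innerAutTop (T := monodromyModel l hl) (tT l)).toMulEquiv.toMonoidHom = PiYddT l) :
    (thetaOrbitData l hl).transport (PiYddT l) (innerAutTop (T := monodromyModel l hl) (tT l)) hY ΓΘ (etaCollLZ l) ≠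
      etaCollLZ l := by
  have hΓΘ : ∀ a, ΓΘ.symm a = a := fun a => by
    rw [MulEquiv.symm_apply_eq, (thetaOrbitData l hl).inducesOnTheta_innerAutTop_eq_act hind, act_eq_self]
  intro h
  have hmem : {etaFn l 1 1} ∈
      (thetaOrbitData l hl).transport (PiYddT l) (innerAutTop (T := monodromyModel l hl) (tT l)) hY ΓΘ (etaCollLZ l) := by
    refine ⟨{etaFn l 1 0}, rfl, ?_⟩
    beta_reduce
    rw [Set.image_singleton, Set.singleton_eq_singleton_iff]
    funext g
    rw [hΓΘ]
    have h01 := etaFn_one_conj_tT l 0 g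
    rw [zero_add] at h01
    exact h01
  rw [h] at hmem
  exact (etaFn_one_one_ne l hl1).1 (Set.singleton_eq_singleton_iff.mp (Set.mem_singleton_iff.mp hmem))

/-- **`¬ Cor28_iii` AT THE MONODROMY TOY** (every odd `l ≠ 1`): clause «`x ∈ Π^tp_{Ẋ̲}` ⇒ `γ_x` preserves `η̈^{Θ,l·ℤ}`»
of the typed [EtTh] Cor. 2.8 (iii) fails for `x = t` at the print-recipe datum of part A — the loop lies in the toy's
`Π^tp_{X̲}` (Def. 2.5 (i)(a) fails there, `not_def25Conditions`), and `γ_t` translates `η₀`.  A NEGATIVE instance of OUR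
typed predicate at a DESIGNED toy, next to abc-iut-w4-d051's `not_forall_cor28_iii`; the positive instance forms at
genuine carriers (abc-iut-L2-t2 `ofEmbedding_cor28_iii_inner`, the χ′ cover of record) are untouched.
refutable-as-typed-at-a-design-carrier ≠ refuted in print; no side taken; typed ≠ proved.
[cite: MochizukiEtTh2009, Cor 2.8(iii) p.42] -/
theorem not_cor28_iii (hl1 : l ≠ 1) : ¬ (thetaOrbitData l hl).Cor28_iii := by
  intro h
  obtain ⟨ΓΘ, hind, -⟩ := (thetaOrbitData l hl).exists_inducesOnTheta_innerAutTop (tT l)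
  have h2 := (h (tT l) ΓΘ hind (map_innerAutTop_tT_PiYddT l hl) (map_innerAutTop_tT_PiYdduu l hl)).2.1
    (tT_mem_dotXu l hl)
  exact transport_innerAutTop_tT_etaCollLZ_ne l hl hl1 hind (map_innerAutTop_tT_PiYddT l hl) h2

/-- **Both typed rigidity rows fail at the same toy datum for the same reason** (`γ_t`), while the datum is of standard
type and clauses C1–C3 of Cor. 2.8 (i) hold for every `Γ` (part B2). [cite: MochizukiEtTh2009, Cor 2.8(iii) p.42] -/
theorem isStandard_and_not_cor28_i_and_not_cor28_iii (hl1 : l ≠ 1) :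
    (thetaOrbitData l hl).IsStandard ∧ ¬ (thetaOrbitData l hl).Cor28_i ∧ ¬ (thetaOrbitData l hl).Cor28_iii :=
  ⟨isStandard_thetaOrbitData l hl, not_cor28_i l hl hl1, not_cor28_iii l hl hl1⟩

end Literature.AnabelianGeometry.EtaleTheta.ThetaCovers.MonodromyModel

end
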